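import Summits.QuantumFields.YangMills.Theorems.SmallFieldWideningWideningOfTiltAndMassTV
import Literature.MathematicalPhysics.QuantumFieldTheory.Balaban1983to89.T3UnitLawDensityEML
import HarnessLib

/-!
# Route `SmallFieldWidening` — THE LIMIT UNIT LAW AT THE PRINTED SMEARING AS AN `L¹(product Haar)` DENSITY
# (support of item `WideningOfTiltAndMass`, stmt-QuantumFields-22885; helper, route-independent)

WHAT THIS IS NOT: not a proof of the route's cruxes r2 (`AllHeightsSmallTilt`, stmt-QuantumFields-22883) or r3
(`LargeFieldMassRefinementTail`, stmt-QuantumFields-22884) — E3 stays open —, not d = 4, not a mass gap, not Clay; rung R3 is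
a RECORD-label rung and no summit is proved here.  Everything is keyed on the HYPOTHESES of the item (the r2- and r3-instances
at every refinement depth `n ≥ n₀`), exactly as the item is.

WHAT IT IS.  The sibling file `…WideningOfTiltAndMassTV` shows that under the item's hypotheses the unit laws
`unitLaw F ℰp γ J` (`SU(2)`, printed smearing) are UNIFORMLY CAUCHY over measurable `|g| ≤ 1`.  At the printed smearing every
unit law IS a density against product Haar on the unit torus, hypothesis-free (tree
`T3UnitLawDensityEML.unitLaw_eq_withDensity_emlDensity`: `unitLaw J = dV_{T₁}.withDensity (Z_J⁻¹ρ̂_J)`).  Hence: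
* §1 (pure measure theory).  Uniform closeness of two laws `ρλ`, `ρ'λ` over measurable `|g| ≤ 1` is EQUIVALENT to `L¹(λ)`
  closeness of the densities (`integral_abs_sub_le_of_withDensity` via the sign observable; `abs_integral_withDensity_sub_le`);
  `L¹`-Cauchy non-negative densities converge in `L¹` to a non-negative measurable density (`exists_limit_density`: completeness
  of `L¹(λ)` = Riesz–Fischer, then a measurable modification and its positive part), of mass one if the approximants have mass
  one (`integral_eq_one_of_tendsto`), giving a probability law (`isProbabilityMeasure_withDensity_of_integral_eq_one`).
* §2 (`SU(2)`, `ℰp`).  Under the item's hypotheses: the normalised renormalised densities `Z_J⁻¹ρ̂_J` of [Balaban1985UV3] (2) are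
  `L¹(dV_{T₁})`-CAUCHY (`unitDensity_L1_uniformCauchy`) and CONVERGE IN `L¹(dV_{T₁})` to a probability density `ρ_∞ ≥ 0`
  (`exists_limitUnitDensity`); the unit laws converge IN TOTAL VARIATION to the absolutely continuous probability law
  `ρ_∞ dV_{T₁}`, uniformly over measurable `|g| ≤ 1` (`exists_limitUnitLaw_TV`), in particular setwise, uniformly in the event
  (`exists_limitUnitLaw_setwise`).  This is the law-level content of E3 at unit resolution in King's own currency («the effective
  densities of the two cut-offs converge», [King1986] Thm 3.4) — typed as a CONSEQUENCE of the route's cruxes, not proved.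
-/

noncomputable section

open MeasureTheory Filter Topology
open scoped ENNReal
open Literature.MathematicalPhysics.QuantumFieldTheory.Balaban1983to89

namespace Summit.QuantumFields.YangMills.Theorems.WideningTVLaw

/-! ## §1 Pure measure theory: densities of uniformly Cauchy laws converge in `L¹` -/

section Abstract

variable {X : Type*} [MeasurableSpace X] (lam : Measure X)

/-- **TOTAL VARIATION CONTROLS THE `L¹` DISTANCE OF DENSITIES**: for real densities `ρ, ρ' ≥ 0` (measurable, integrable) the
`L¹(λ)` distance `∫ |ρ − ρ'| dλ` is `∫ g d(ρλ) − ∫ g d(ρ'λ)` for the measurable sign observable `g = 𝟙{ρ' ≤ ρ} − 𝟙{ρ' > ρ}`,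
`|g| ≤ 1`; hence it is bounded by any bound on the laws' differences over measurable `|g| ≤ 1`. -/
theorem integral_abs_sub_le_of_withDensity {ρ ρ' : X → ℝ} (hm : Measurable ρ) (hm' : Measurable ρ')
    (h0 : ∀ x, 0 ≤ ρ x) (h0' : ∀ x, 0 ≤ ρ' x) (hi : Integrable ρ lam) (hi' : Integrable ρ' lam) {ε : ℝ}
    (hC : ∀ g : X → ℝ, Measurable g → (∀ x, |g x| ≤ 1) →
      |(∫ x, g x ∂lam.withDensity (fun x => ENNReal.ofReal (ρ x))) -
        ∫ x, g x ∂lam.withDensity (fun x => ENNReal.ofReal (ρ' x))| ≤ ε) :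
    ∫ x, |ρ x - ρ' x| ∂lam ≤ ε := by
  set g : X → ℝ := fun x => if ρ' x ≤ ρ x then 1 else -1 with hg
  have hgm : Measurable g := Measurable.ite (measurableSet_le hm' hm) measurable_const measurable_const
  have hg1 : ∀ x, |g x| ≤ 1 := fun x => by
    simp only [hg]; split_ifs <;> simp
  have hgn : ∀ x, ‖g x‖ ≤ 1 := fun x => by rw [Real.norm_eq_abs]; exact hg1 x
  have h := hC g hgm hg1
  rw [T4VarianceMatching.integral_withDensity_ofReal_mul hm h0 g,
    T4VarianceMatching.integral_withDensity_ofReal_mul hm' h0' g,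
    ← integral_sub (hi.mul_bdd hgm.aestronglyMeasurable (ae_of_all _ hgn))
      (hi'.mul_bdd hgm.aestronglyMeasurable (ae_of_all _ hgn))] at h
  have hpt : ∀ x, |ρ x - ρ' x| = ρ x * g x - ρ' x * g x := fun x => by
    simp only [hg]
    split_ifs with hle
    · rw [abs_of_nonneg (by linarith)]; ring
    · rw [abs_of_neg (by linarith [lt_of_not_ge hle])]; ring
  calc ∫ x, |ρ x - ρ' x| ∂lam = ∫ x, (ρ x * g x - ρ' x * g x) ∂lam :=
        integral_congr_ae (ae_of_all _ fun x => hpt x)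
    _ ≤ |∫ x, (ρ x * g x - ρ' x * g x) ∂lam| := le_abs_self _
    _ ≤ ε := h

/-- **BOUNDED OBSERVABLES SEE AT MOST THE `L¹` DISTANCE** (converse direction): for densities `ρ, ρ' ≥ 0` and measurable
`|g| ≤ 1`, `|∫ g d(ρλ) − ∫ g d(ρ'λ)| ≤ ∫ |ρ − ρ'| dλ`. -/
theorem abs_integral_withDensity_sub_le {ρ ρ' : X → ℝ} (hm : Measurable ρ) (hm' : Measurable ρ')
    (h0 : ∀ x, 0 ≤ ρ x) (h0' : ∀ x, 0 ≤ ρ' x) (hi : Integrable ρ lam) (hi' : Integrable ρ' lam)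
    {g : X → ℝ} (hgm : Measurable g) (hg1 : ∀ x, |g x| ≤ 1) :
    |(∫ x, g x ∂lam.withDensity (fun x => ENNReal.ofReal (ρ x))) -
        ∫ x, g x ∂lam.withDensity (fun x => ENNReal.ofReal (ρ' x))| ≤ ∫ x, |ρ x - ρ' x| ∂lam := by
  have hgn : ∀ x, ‖g x‖ ≤ 1 := fun x => by rw [Real.norm_eq_abs]; exact hg1 x
  rw [T4VarianceMatching.integral_withDensity_ofReal_mul hm h0 g,
    T4VarianceMatching.integral_withDensity_ofReal_mul hm' h0' g,
    ← integral_sub (hi.mul_bdd hgm.aestronglyMeasurable (ae_of_all _ hgn))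
      (hi'.mul_bdd hgm.aestronglyMeasurable (ae_of_all _ hgn))]
  refine (abs_integral_le_integral_abs).trans (integral_mono_of_nonneg (ae_of_all _ fun x => abs_nonneg _)
    ((hi.sub hi').abs) (ae_of_all _ fun x => ?_))
  show |ρ x * g x - ρ' x * g x| ≤ |ρ x - ρ' x|
  rw [← sub_mul, abs_mul]
  exact mul_le_of_le_one_right (abs_nonneg _) (hg1 x)

/-- Elementary: for `a ≥ 0`, replacing `b` by its positive part does not increase `|a − b|`. -/
theorem abs_sub_max_zero_le {a b : ℝ} (ha : 0 ≤ a) : |a - max b 0| ≤ |a - b| := by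
  rcases le_or_gt 0 b with hb | hb
  · rw [max_eq_left hb]
  · rw [max_eq_right hb.le, sub_zero, abs_of_nonneg ha]
    have h : a ≤ a - b := by linarith
    exact h.trans (le_abs_self _)

/-- **`L¹`-CAUCHY NON-NEGATIVE DENSITIES CONVERGE IN `L¹` TO A NON-NEGATIVE MEASURABLE DENSITY** (completeness of `L¹(λ)`,
Riesz–Fischer; the limit class is given an everywhere non-negative measurable representative by taking the positive part of a
measurable modification, which costs nothing in `L¹` against non-negative `ρ_J`). -/
theorem exists_limit_density (ρ : ℕ → X → ℝ) (h0 : ∀ J x, 0 ≤ ρ J x)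
    (hi : ∀ J, Integrable (ρ J) lam)
    (hC : ∀ ε : ℝ, 0 < ε → ∃ J₀ : ℕ, ∀ J J' : ℕ, J₀ ≤ J → J₀ ≤ J' → ∫ x, |ρ J x - ρ J' x| ∂lam ≤ ε) :
    ∃ ρl : X → ℝ, Measurable ρl ∧ (∀ x, 0 ≤ ρl x) ∧ Integrable ρl lam ∧
      Tendsto (fun J => ∫ x, |ρ J x - ρl x| ∂lam) atTop (𝓝 0) := by
  -- the `L¹` classes of the densities and their distances
  let u : ℕ → (X →₁[lam] ℝ) := fun J => (hi J).toL1 (ρ J)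
  have hdist : ∀ J J', dist (u J) (u J') = ∫ x, |ρ J x - ρ J' x| ∂lam := fun J J' => by
    rw [L1.dist_eq_integral_dist]
    refine integral_congr_ae ?_
    filter_upwards [(hi J).coeFn_toL1, (hi J').coeFn_toL1] with x hx hx'
    rw [hx, hx', Real.dist_eq]
  have hcau : CauchySeq u := Metric.cauchySeq_iff.mpr fun ε hε => by
    obtain ⟨J₀, hJ₀⟩ := hC (ε / 2) (half_pos hε)
    exact ⟨J₀, fun J hJ J' hJ' => by rw [hdist]; exact (hJ₀ J J' hJ hJ').trans_lt (half_lt_self hε)⟩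
  obtain ⟨v, hv⟩ := cauchySeq_tendsto_of_complete hcau
  -- a measurable, everywhere non-negative representative of the limit class
  have hvae : AEMeasurable (v : X → ℝ) lam := (Lp.aestronglyMeasurable v).aemeasurable
  have hwm : Measurable (hvae.mk (v : X → ℝ)) := hvae.measurable_mk
  have hvw : (v : X → ℝ) =ᵐ[lam] hvae.mk (v : X → ℝ) := hvae.ae_eq_mk
  have hwi : Integrable (hvae.mk (v : X → ℝ)) lam := (L1.integrable_coeFn v).congr hvw
  refine ⟨fun x => max (hvae.mk (v : X → ℝ) x) 0, hwm.max measurable_const, fun x => le_max_right _ _,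
    hwi.pos_part, ?_⟩
  have hlim : Tendsto (fun J => dist (u J) v) atTop (𝓝 0) := tendsto_iff_dist_tendsto_zero.mp hv
  have hdv : ∀ J, dist (u J) v = ∫ x, |ρ J x - hvae.mk (v : X → ℝ) x| ∂lam := fun J => by
    rw [L1.dist_eq_integral_dist]
    refine integral_congr_ae ?_
    filter_upwards [(hi J).coeFn_toL1, hvw] with x hx hx'
    rw [hx, hx', Real.dist_eq]
  refine squeeze_zero (fun J => integral_nonneg fun x => abs_nonneg _) (fun J => ?_) hlim
  rw [hdv J]
  exact integral_mono ((hi J).sub hwi.pos_part).abs ((hi J).sub hwi).abs fun x => abs_sub_max_zero_le (h0 J x)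

/-- **THE LIMIT DENSITY HAS MASS ONE** if the approximating densities do (`∫ ρ_J dλ = 1`, `∫ |ρ_J − ρ_∞| dλ → 0`). -/
theorem integral_eq_one_of_tendsto {ρ : ℕ → X → ℝ} {ρl : X → ℝ} (hi : ∀ J, Integrable (ρ J) lam)
    (hil : Integrable ρl lam) (h1 : ∀ J, ∫ x, ρ J x ∂lam = 1)
    (hlim : Tendsto (fun J => ∫ x, |ρ J x - ρl x| ∂lam) atTop (𝓝 0)) : ∫ x, ρl x ∂lam = 1 := by
  have ht : Tendsto (fun J => ∫ x, ρ J x ∂lam) atTop (𝓝 (∫ x, ρl x ∂lam)) := by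
    refine tendsto_iff_dist_tendsto_zero.mpr (squeeze_zero (fun J => dist_nonneg) (fun J => ?_) hlim)
    rw [Real.dist_eq, ← integral_sub (hi J) hil]
    exact abs_integral_le_integral_abs
  have hc : Tendsto (fun J => ∫ x, ρ J x ∂lam) atTop (𝓝 1) := by
    simp_rw [h1]; exact tendsto_const_nhds
  exact tendsto_nhds_unique ht hc

/-- **A NON-NEGATIVE DENSITY OF MASS ONE GIVES A PROBABILITY LAW** `λ.withDensity ρ`. -/
theorem isProbabilityMeasure_withDensity_of_integral_eq_one {ρl : X → ℝ} (h0 : ∀ x, 0 ≤ ρl x)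
    (hil : Integrable ρl lam) (h1 : ∫ x, ρl x ∂lam = 1) :
    IsProbabilityMeasure (lam.withDensity fun x => ENNReal.ofReal (ρl x)) := by
  refine ⟨?_⟩
  rw [withDensity_apply _ MeasurableSet.univ, Measure.restrict_univ,
    ← ofReal_integral_eq_lintegral_ofReal hil (ae_of_all _ h0), h1, ENNReal.ofReal_one]

end Abstract

/-! ## §2 The unit laws at the printed smearing: `L¹` convergence of `Z_J⁻¹ρ̂_J`, total-variation limit law -/

section UnitLaw

open Literature.MathematicalPhysics.QuantumFieldTheory.Balaban1983to89.Missing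
open Literature.MathematicalPhysics.QuantumFieldTheory.Balaban1983to89.T3ContinuumYM3Torus
open Literature.MathematicalPhysics.QuantumFieldTheory.Balaban1983to89.T3ThresholdRemoval
open Literature.MathematicalPhysics.QuantumFieldTheory.Balaban1983to89.T3UnitLawDensityEML
open Literature.MathematicalPhysics.QuantumFieldTheory.Balaban1983to89.T3UnitScaleTilt
open Summit.QuantumFields.YangMills.Theorems.WideningTV

variable (F : T3Family)

/-- **THE NORMALISED RENORMALISED DENSITIES ARE `L¹(dV_{T₁})`-CAUCHY** (`SU(2)`, `ℰp`): under the hypotheses of the item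
`WideningOfTiltAndMass`, for every `ε > 0` there is `J₀` with `∫ |Z_J⁻¹ρ̂_J − Z_{J'}⁻¹ρ̂_{J'}| dV_{T₁} ≤ ε` for all `J, J' ≥ J₀`
(uniformly Cauchy unit laws, `WideningTV.unitLaw_uniformCauchy`, tested on the sign observable; `unitLaw J = Z_J⁻¹ρ̂_J dV_{T₁}` by
`unitLaw_eq_withDensity_emlDensity`). -/
theorem unitDensity_L1_uniformCauchy {γ b₀ p₀ : ℝ} (n₀ : ℕ) (hγ : 0 < γ)
    (hT : ∀ n : ℕ, n₀ ≤ n → UnitTiltAt (F.refine n) (γ * ((F.L : ℝ)⁻¹) ^ n) b₀ p₀ 0)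
    (hM : ∃ δ : ℕ → ℝ, Tendsto δ atTop (𝓝 0) ∧ ∀ n K : ℕ, n₀ ≤ n →
      (gibbsK (F.refine n) ℰp (γ * ((F.L : ℝ)⁻¹) ^ n) K).real
        (histGood (F.refine n) ℰp (θBal (F.refine n).L (γ * ((F.L : ℝ)⁻¹) ^ n) b₀ p₀) K 0)ᶜ ≤ δ n)
    {ε : ℝ} (hε : 0 < ε) :
    ∃ J₀ : ℕ, ∀ J J' : ℕ, J₀ ≤ J → J₀ ≤ J' →
      ∫ u, |(partitionFn (G := Matrix.specialUnitaryGroup (Fin 2) ℂ) (F.P J) ((F.scheme ℰp γ).β J))⁻¹ *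
            unitDensity F γ J u -
          (partitionFn (G := Matrix.specialUnitaryGroup (Fin 2) ℂ) (F.P J') ((F.scheme ℰp γ).β J'))⁻¹ *
            unitDensity F γ J' u| ∂fieldMeasure (F.P 0) 0 (Matrix.specialUnitaryGroup (Fin 2) ℂ) ≤ ε := by
  obtain ⟨J₀, hJ₀⟩ := unitLaw_uniformCauchy F n₀ hγ hT hM hε
  refine ⟨J₀, fun J J' hJ hJ' => ?_⟩
  obtain ⟨hdm, hd0, hdi⟩ := unitDensity_props F J hγ.le
  obtain ⟨hdm', hd0', hdi'⟩ := unitDensity_props F J' hγ.le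
  have hZ : 0 < partitionFn (G := Matrix.specialUnitaryGroup (Fin 2) ℂ) (F.P J) ((F.scheme ℰp γ).β J) :=
    partitionFn_pos' _ (F.scheme_β_nonneg ℰp hγ.le J)
  have hZ' : 0 < partitionFn (G := Matrix.specialUnitaryGroup (Fin 2) ℂ) (F.P J') ((F.scheme ℰp γ).β J') :=
    partitionFn_pos' _ (F.scheme_β_nonneg ℰp hγ.le J')
  refine integral_abs_sub_le_of_withDensity _ (hdm.const_mul _) (hdm'.const_mul _)
    (fun u => mul_nonneg (inv_nonneg.mpr hZ.le) (hd0 u)) (fun u => mul_nonneg (inv_nonneg.mpr hZ'.le) (hd0' u))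
    (hdi.const_mul _) (hdi'.const_mul _) fun g hgm hg1 => ?_
  rw [← unitLaw_eq_withDensity_emlDensity F J hγ.le, ← unitLaw_eq_withDensity_emlDensity F J' hγ.le]
  exact hJ₀ J J' hJ hJ' g hgm hg1

/-- **THE EFFECTIVE DENSITIES CONVERGE IN `L¹(dV_{T₁})`** (`SU(2)`, `ℰp`; the law-level E3 at unit resolution AS A CONSEQUENCE of
the item's hypotheses): there is a measurable probability density `ρ_∞ ≥ 0` on the unit-torus gauge fields, `∫ ρ_∞ dV_{T₁} = 1`,
with `∫ |Z_J⁻¹ρ̂_J − ρ_∞| dV_{T₁} → 0` as `J → ∞`.  No crux and no summit is proved here. -/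
theorem exists_limitUnitDensity {γ b₀ p₀ : ℝ} (n₀ : ℕ) (hγ : 0 < γ)
    (hT : ∀ n : ℕ, n₀ ≤ n → UnitTiltAt (F.refine n) (γ * ((F.L : ℝ)⁻¹) ^ n) b₀ p₀ 0)
    (hM : ∃ δ : ℕ → ℝ, Tendsto δ atTop (𝓝 0) ∧ ∀ n K : ℕ, n₀ ≤ n →
      (gibbsK (F.refine n) ℰp (γ * ((F.L : ℝ)⁻¹) ^ n) K).real
        (histGood (F.refine n) ℰp (θBal (F.refine n).L (γ * ((F.L : ℝ)⁻¹) ^ n) b₀ p₀) K 0)ᶜ ≤ δ n) :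
    ∃ ρl : GaugeField (F.P 0) 0 (Matrix.specialUnitaryGroup (Fin 2) ℂ) → ℝ, Measurable ρl ∧ (∀ u, 0 ≤ ρl u) ∧
      Integrable ρl (fieldMeasure (F.P 0) 0 (Matrix.specialUnitaryGroup (Fin 2) ℂ)) ∧
      ∫ u, ρl u ∂fieldMeasure (F.P 0) 0 (Matrix.specialUnitaryGroup (Fin 2) ℂ) = 1 ∧
      Tendsto (fun J => ∫ u, |(partitionFn (G := Matrix.specialUnitaryGroup (Fin 2) ℂ) (F.P J)
          ((F.scheme ℰp γ).β J))⁻¹ * unitDensity F γ J u - ρl u|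
        ∂fieldMeasure (F.P 0) 0 (Matrix.specialUnitaryGroup (Fin 2) ℂ)) atTop (𝓝 0) := by
  have hZ : ∀ J, 0 < partitionFn (G := Matrix.specialUnitaryGroup (Fin 2) ℂ) (F.P J) ((F.scheme ℰp γ).β J) := fun J =>
    partitionFn_pos' _ (F.scheme_β_nonneg ℰp hγ.le J)
  have h0 : ∀ J u, 0 ≤ (partitionFn (G := Matrix.specialUnitaryGroup (Fin 2) ℂ) (F.P J) ((F.scheme ℰp γ).β J))⁻¹ *
      unitDensity F γ J u := fun J u => mul_nonneg (inv_nonneg.mpr (hZ J).le) ((unitDensity_props F J hγ.le).2.1 u)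
  have hi : ∀ J, Integrable (fun u => (partitionFn (G := Matrix.specialUnitaryGroup (Fin 2) ℂ) (F.P J)
      ((F.scheme ℰp γ).β J))⁻¹ * unitDensity F γ J u) (fieldMeasure (F.P 0) 0 (Matrix.specialUnitaryGroup (Fin 2) ℂ)) :=
    fun J => (unitDensity_props F J hγ.le).2.2.const_mul _
  obtain ⟨ρl, hm, hl0, hil, hlim⟩ := exists_limit_density (fieldMeasure (F.P 0) 0 (Matrix.specialUnitaryGroup (Fin 2) ℂ))
    (fun J u => (partitionFn (G := Matrix.specialUnitaryGroup (Fin 2) ℂ) (F.P J) ((F.scheme ℰp γ).β J))⁻¹ *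
      unitDensity F γ J u) h0 hi (fun ε hε => unitDensity_L1_uniformCauchy F n₀ hγ hT hM hε)
  refine ⟨ρl, hm, hl0, hil, integral_eq_one_of_tendsto _ hi hil (fun J => ?_) hlim, hlim⟩
  haveI : IsProbabilityMeasure ((fieldMeasure (F.P 0) 0 (Matrix.specialUnitaryGroup (Fin 2) ℂ)).withDensity fun u =>
      ENNReal.ofReal ((partitionFn (G := Matrix.specialUnitaryGroup (Fin 2) ℂ) (F.P J) ((F.scheme ℰp γ).β J))⁻¹ *
        unitDensity F γ J u)) := by
    rw [← unitLaw_eq_withDensity_emlDensity F J hγ.le]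
    exact isProbabilityMeasure_unitLaw measurableE_ℰp hγ.le J
  exact T4VarianceMatching.integral_density_eq_one ((unitDensity_props F J hγ.le).1.const_mul _) (h0 J)

/-- **THE UNIT LAWS CONVERGE IN TOTAL VARIATION TO AN ABSOLUTELY CONTINUOUS PROBABILITY LAW `ρ_∞ dV_{T₁}`** (`SU(2)`, `ℰp`;
under the item's hypotheses): there is a probability density `ρ_∞ ≥ 0` for product Haar on the unit torus such that for every
`ε > 0` some `J₀` serves ALL measurable `|g| ≤ 1` at once: `|∫ g d(unitLaw J) − ∫ g ρ_∞ dV_{T₁}| ≤ ε` for `J ≥ J₀`.  The item's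
`HasContinuumLimit` is the special case of the unit-loop products, one string at a time.  No crux and no summit is proved here. -/
theorem exists_limitUnitLaw_TV {γ b₀ p₀ : ℝ} (n₀ : ℕ) (hγ : 0 < γ)
    (hT : ∀ n : ℕ, n₀ ≤ n → UnitTiltAt (F.refine n) (γ * ((F.L : ℝ)⁻¹) ^ n) b₀ p₀ 0)
    (hM : ∃ δ : ℕ → ℝ, Tendsto δ atTop (𝓝 0) ∧ ∀ n K : ℕ, n₀ ≤ n →
      (gibbsK (F.refine n) ℰp (γ * ((F.L : ℝ)⁻¹) ^ n) K).real
        (histGood (F.refine n) ℰp (θBal (F.refine n).L (γ * ((F.L : ℝ)⁻¹) ^ n) b₀ p₀) K 0)ᶜ ≤ δ n) :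
    ∃ ρl : GaugeField (F.P 0) 0 (Matrix.specialUnitaryGroup (Fin 2) ℂ) → ℝ, Measurable ρl ∧ (∀ u, 0 ≤ ρl u) ∧
      Integrable ρl (fieldMeasure (F.P 0) 0 (Matrix.specialUnitaryGroup (Fin 2) ℂ)) ∧
      IsProbabilityMeasure ((fieldMeasure (F.P 0) 0 (Matrix.specialUnitaryGroup (Fin 2) ℂ)).withDensity
        fun u => ENNReal.ofReal (ρl u)) ∧
      ∀ ε : ℝ, 0 < ε → ∃ J₀ : ℕ, ∀ J : ℕ, J₀ ≤ J →
        ∀ g : GaugeField (F.P 0) 0 (Matrix.specialUnitaryGroup (Fin 2) ℂ) → ℝ, Measurable g → (∀ u, |g u| ≤ 1) →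
          |(∫ u, g u ∂F.unitLaw ℰp measurableE_ℰp γ J) -
              ∫ u, g u ∂(fieldMeasure (F.P 0) 0 (Matrix.specialUnitaryGroup (Fin 2) ℂ)).withDensity
                fun u => ENNReal.ofReal (ρl u)| ≤ ε := by
  obtain ⟨ρl, hm, hl0, hil, h1, hlim⟩ := exists_limitUnitDensity F n₀ hγ hT hM
  refine ⟨ρl, hm, hl0, hil, isProbabilityMeasure_withDensity_of_integral_eq_one _ hl0 hil h1, fun ε hε => ?_⟩
  obtain ⟨J₀, hJ₀⟩ := Metric.tendsto_atTop.mp hlim ε hε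
  refine ⟨J₀, fun J hJ g hgm hg1 => ?_⟩
  have hZ : 0 < partitionFn (G := Matrix.specialUnitaryGroup (Fin 2) ℂ) (F.P J) ((F.scheme ℰp γ).β J) :=
    partitionFn_pos' _ (F.scheme_β_nonneg ℰp hγ.le J)
  obtain ⟨hdm, hd0, hdi⟩ := unitDensity_props F J hγ.le
  have h := hJ₀ J hJ
  rw [Real.dist_eq, sub_zero, abs_of_nonneg (integral_nonneg fun u => abs_nonneg _)] at h
  rw [unitLaw_eq_withDensity_emlDensity F J hγ.le]
  exact (abs_integral_withDensity_sub_le _ (hdm.const_mul _) hm (fun u => mul_nonneg (inv_nonneg.mpr hZ.le) (hd0 u)) hl0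
    (hdi.const_mul _) hil hgm hg1).trans h.le

/-- **SETWISE, UNIFORMLY IN THE EVENT**: under the item's hypotheses there is an absolutely continuous probability law
`ν = ρ_∞ dV_{T₁}` on the unit-torus gauge fields with `sup_A |unitLaw_J(A) − ν(A)| → 0` over measurable events `A` (indicators in
`exists_limitUnitLaw_TV`). -/
theorem exists_limitUnitLaw_setwise {γ b₀ p₀ : ℝ} (n₀ : ℕ) (hγ : 0 < γ)
    (hT : ∀ n : ℕ, n₀ ≤ n → UnitTiltAt (F.refine n) (γ * ((F.L : ℝ)⁻¹) ^ n) b₀ p₀ 0)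
    (hM : ∃ δ : ℕ → ℝ, Tendsto δ atTop (𝓝 0) ∧ ∀ n K : ℕ, n₀ ≤ n →
      (gibbsK (F.refine n) ℰp (γ * ((F.L : ℝ)⁻¹) ^ n) K).real
        (histGood (F.refine n) ℰp (θBal (F.refine n).L (γ * ((F.L : ℝ)⁻¹) ^ n) b₀ p₀) K 0)ᶜ ≤ δ n) :
    ∃ ν : Measure (GaugeField (F.P 0) 0 (Matrix.specialUnitaryGroup (Fin 2) ℂ)), IsProbabilityMeasure ν ∧
      ν ≪ fieldMeasure (F.P 0) 0 (Matrix.specialUnitaryGroup (Fin 2) ℂ) ∧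
      ∀ ε : ℝ, 0 < ε → ∃ J₀ : ℕ, ∀ J : ℕ, J₀ ≤ J →
        ∀ A : Set (GaugeField (F.P 0) 0 (Matrix.specialUnitaryGroup (Fin 2) ℂ)), MeasurableSet A →
          |(F.unitLaw ℰp measurableE_ℰp γ J).real A - ν.real A| ≤ ε := by
  obtain ⟨ρl, _, _, _, hP, hTV⟩ := exists_limitUnitLaw_TV F n₀ hγ hT hM
  refine ⟨_, hP, withDensity_absolutelyContinuous _ _, fun ε hε => ?_⟩
  obtain ⟨J₀, hJ₀⟩ := hTV ε hε
  refine ⟨J₀, fun J hJ A hA => ?_⟩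
  haveI := isProbabilityMeasure_unitLaw (F := F) (ℰ := ℰp) measurableE_ℰp hγ.le J
  have hb : ∀ y, |A.indicator (1 : GaugeField (F.P 0) 0 (Matrix.specialUnitaryGroup (Fin 2) ℂ) → ℝ) y| ≤ 1 := fun y => by
    by_cases hy : y ∈ A
    · simp [hy]
    · simp [hy]
  have h := hJ₀ J hJ _ (measurable_one.indicator hA) hb
  rwa [integral_indicator_one hA, integral_indicator_one hA] at h

end UnitLaw

end Summit.QuantumFields.YangMills.Theorems.WideningTVLaw

end
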